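import Mathlib
import Literature.Computability.AlgebraicComplexity.LinSubst
import Summits.ValiantsHypothesis.ValiantsHypothesis.Theorems.BorderApolarityFixedWitnessObstructionQPH0Elementary

/-!
# Border apolarity, crux `ToricWitnessObstructionQP` (stmt-ValiantsHypothesis-14753) — line `Sketch`,
# reshape 4, stub `stub_stabScalarBorel`

Route `ValiantsHypothesis/BorderApolarity`, crux item `stmt-ValiantsHypothesis-14753`, line `Sketch`,
reshape 4 (the stable normal form), stub `stub_stabScalarBorel`: two unpackings of the raw stability
clause W4.  Write `σ := Fin m × Fin m`, call a variable `a` *own* if `m - n ≤ a.1 ∧ m - n ≤ a.2` or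
`a = (0,0)` and *unused* otherwise, and let `H₀` be the set of invertible matrices `M` on `σ` which are
(a) triangular for the order `rk` (own first, unused last), (b) diagonal on the own columns, (c) rank-one
on the block diagonal and (d) of character `M₀₀^{m-n} ∏ M_{(ii)(ii)} = 1`.  The raw clause says that
each `J' k` (`k ≤ m`) is stable under `D ↦ linSubst ((p⁻¹ A p)ᵀ) D` for every `A ∈ H₀`, where the own
columns of `p` are coordinate vectors.

* (i) clean unused scalings: for `c ≠ 0` the matrix `D_c := diag(1_own, c·1_unused)` satisfies
  `p D_c p⁻¹ = c·1 + (1-c)·diag(𝟙_own) p⁻¹` (the own columns of `p` and of `p⁻¹` are coordinate), an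
  element of `H₀` (own columns coordinate, its only other off-diagonal entries sit in own rows of unused
  columns), and `p⁻¹ (p D_c p⁻¹) p = D_c`; so W4 gives stability under `linSubst D_c` directly.
* (ii) every invertible `L` with coordinate own columns and `rk`-triangular unused block lies in `H₀`
  verbatim (an off-diagonal entry in an unused column and an own row is allowed since
  `rk own < m² ≤ rk unused`, `fst_mul_add_snd_lt`).
-/

open MvPolynomial Filter
open scoped BigOperators Matrix
open Literature.Computability.AlgebraicComplexity

set_option linter.dupNamespace false

namespace Summit.ValiantsHypothesis.ValiantsHypothesis.Theorems.BorderApolarityToricWitnessObstructionQP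

open Summit.ValiantsHypothesis.ValiantsHypothesis.Theorems.BorderApolarityFixedWitnessObstructionQP
  (fst_mul_add_snd_lt)

/-- If `Pi * P = 1` and column `a` of `P` is the coordinate vector `e_a`, then column `a` of `Pi` is
`e_a` as well. [folklore] -/
theorem stabSB_inv_coordCol {σ R : Type*} [Fintype σ] [DecidableEq σ] [CommRing R]
    {P Pi : Matrix σ σ R} (h : Pi * P = 1) {a : σ} (ha : ∀ b, P b a = if b = a then 1 else 0)
    (b : σ) : Pi b a = if b = a then 1 else 0 := by
  have h1 := congrFun (congrFun h b) a
  rw [Matrix.mul_apply, Matrix.one_apply] at h1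
  simp_rw [ha, mul_ite, mul_one, mul_zero, Fintype.sum_ite_eq'] at h1
  exact h1

/-- The conjugate of the clean scaling `diag(1_ess, c·1_¬ess)` by a matrix `P` whose `ess`-columns are
coordinate vectors: `P · diag · P⁻¹ = c·1 + (1-c)·(diag 𝟙_ess · P⁻¹)`. [folklore] -/
theorem stabSB_conj_diagonal {σ R : Type*} [Fintype σ] [DecidableEq σ] [CommRing R]
    (ess : σ → Prop) [DecidablePred ess] {P Pi : Matrix σ σ R} (h : P * Pi = 1)
    (hP : ∀ a, ess a → ∀ b, P b a = if b = a then 1 else 0) (c : R) :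
    P * Matrix.diagonal (fun i => if ess i then 1 else c) * Pi =
      c • (1 : Matrix σ σ R) +
        (1 - c) • (Matrix.diagonal (fun i => if ess i then (1 : R) else 0) * Pi) := by
  have hD : Matrix.diagonal (fun i => if ess i then 1 else c) =
      c • (1 : Matrix σ σ R) + (1 - c) • Matrix.diagonal (fun i => if ess i then (1 : R) else 0) := by
    ext i j
    simp only [Matrix.add_apply, Matrix.smul_apply, Matrix.diagonal_apply, Matrix.one_apply,
      smul_eq_mul]
    split_ifs <;> ring
  have hPD : P * Matrix.diagonal (fun i => if ess i then (1 : R) else 0) =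
      Matrix.diagonal (fun i => if ess i then (1 : R) else 0) := by
    ext b l
    simp only [Matrix.mul_diagonal, Matrix.diagonal_apply]
    by_cases hl : ess l
    · rw [hP l hl b]
      by_cases hbl : b = l
      · subst hbl
        simp [hl]
      · simp [hbl]
    · by_cases hbl : b = l
      · subst hbl
        simp [hl]
      · simp [hbl, hl]
  rw [hD, Matrix.mul_add, Matrix.add_mul, Matrix.mul_smul, Matrix.mul_one, Matrix.smul_mul, h,
    Matrix.mul_smul, hPD, Matrix.smul_mul]

/-- Diagonal `ess`-entries of `c·1 + (1-c)·(diag 𝟙_ess · Pi)` are `1` when the `ess`-columns of `Pi`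
are coordinate vectors. [folklore] -/
theorem stabSB_conj_entry_diag {σ R : Type*} [Fintype σ] [DecidableEq σ] [CommRing R]
    (ess : σ → Prop) [DecidablePred ess] {Pi : Matrix σ σ R}
    (hPi : ∀ a, ess a → ∀ b, Pi b a = if b = a then 1 else 0) (c : R) {i : σ} (hi : ess i) :
    (c • (1 : Matrix σ σ R) +
      (1 - c) • (Matrix.diagonal (fun i => if ess i then (1 : R) else 0) * Pi)) i i = 1 := by
  have h1 : Pi i i = 1 := (hPi i hi i).trans (if_pos rfl)
  simp only [Matrix.add_apply, Matrix.smul_apply, smul_eq_mul, Matrix.one_apply_eq,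
    Matrix.diagonal_mul, h1, if_pos hi]
  ring

/-- A nonzero off-diagonal entry `(j, i)` of `c·1 + (1-c)·(diag 𝟙_ess · Pi)` (with coordinate
`ess`-columns of `Pi`) has `ess j` and `¬ ess i`. [folklore] -/
theorem stabSB_conj_entry_offdiag {σ R : Type*} [Fintype σ] [DecidableEq σ] [CommRing R]
    (ess : σ → Prop) [DecidablePred ess] {Pi : Matrix σ σ R}
    (hPi : ∀ a, ess a → ∀ b, Pi b a = if b = a then 1 else 0) (c : R) {i j : σ} (hji : j ≠ i)
    (h : (c • (1 : Matrix σ σ R) +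
      (1 - c) • (Matrix.diagonal (fun i => if ess i then (1 : R) else 0) * Pi)) j i ≠ 0) :
    ess j ∧ ¬ ess i := by
  rw [Matrix.add_apply, Matrix.smul_apply, Matrix.smul_apply, Matrix.one_apply_ne hji, smul_zero,
    zero_add, Matrix.diagonal_mul, smul_eq_mul] at h
  by_cases hj : ess j
  · refine ⟨hj, fun hi => h ?_⟩
    rw [hPi i hi j, if_neg hji, mul_zero, mul_zero]
  · exact (h (by rw [if_neg hj, zero_mul, mul_zero])).elim

/-- **Stub 6 — unused-variable scalings and the conjugate unused Borel (unpacking W4, III).**  Under the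
raw stability clause (each `J' k`, `k ≤ m`, is stable under `linSubst ((p⁻¹ A p)ᵀ)` for every `A ∈ H₀`,
the own columns of `p` being coordinate vectors): (i) `J'` is stable under the CLEAN scalings
`∂_z ↦ c ∂_z` of all unused variables at once (`c ≠ 0`): with `D_c := diag(1_own, c·1_unused)` the
conjugate `p D_c p⁻¹ = c·1 + (1-c)·diag(𝟙_own) p⁻¹` lies in `H₀` and `p⁻¹ (p D_c p⁻¹) p = D_c`;
(ii) `J'` is stable under `(p⁻¹ L p)ᵀ` for every invertible `L` whose own columns are coordinate and
whose unused block is triangular for `rk` (`L ∈ H₀` verbatim).  The Hom-stability hypothesis is not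
needed. [folklore] -/
theorem stub_stabScalarBorel : ∀ (n m : ℕ) [NeZero m] (p : GL (Fin m × Fin m) ℂ)
    (J' : ℕ → Set (MvPolynomial (Fin m × Fin m) ℂ)),
    (∀ a : Fin m × Fin m, ((m - n ≤ (a.1 : ℕ) ∧ m - n ≤ (a.2 : ℕ)) ∨ a = (0, 0)) →
      ∀ b : Fin m × Fin m, (p : Matrix (Fin m × Fin m) (Fin m × Fin m) ℂ) b a = if b = a then 1 else 0) →
    (∀ A : Matrix.GeneralLinearGroup (Fin m × Fin m) ℂ,
      let M : Matrix (Fin m × Fin m) (Fin m × Fin m) ℂ := A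
      let rk := fun (q : Fin m × Fin m) =>
        (if (m - n ≤ (q.1 : ℕ) ∧ m - n ≤ (q.2 : ℕ)) ∨ q = (0, 0) then 0 else m * m) + ((q.1 : ℕ) * m + (q.2 : ℕ))
      (∀ i j : Fin m × Fin m, M j i ≠ 0 → rk j ≤ rk i) →
      (∀ i j : Fin m × Fin m, ((m - n ≤ (i.1 : ℕ) ∧ m - n ≤ (i.2 : ℕ)) ∨ i = (0, 0)) → j ≠ i → M j i = 0) →
      (∀ i k j l : Fin m, m - n ≤ (i : ℕ) → m - n ≤ (k : ℕ) → m - n ≤ (j : ℕ) → m - n ≤ (l : ℕ) →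
        M (i, j) (i, j) * M (k, l) (k, l) = M (i, l) (i, l) * M (k, j) (k, j)) →
      M (0, 0) (0, 0) ^ (m - n) * ∏ i ∈ Finset.univ.filter (fun i : Fin m => m - n ≤ (i : ℕ)), M (i, i) (i, i) = 1 →
      ∀ k ≤ m, ∀ D ∈ J' k,
        linSubst (Fin m × Fin m) ℂ (((p⁻¹ : GL (Fin m × Fin m) ℂ) : Matrix (Fin m × Fin m) (Fin m × Fin m) ℂ) *
          M * (p : Matrix (Fin m × Fin m) (Fin m × Fin m) ℂ))ᵀ D ∈ J' k) →
    (∀ C : Matrix (Fin m × Fin m) (Fin m × Fin m) ℂ,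
      (∀ j i : Fin m × Fin m, C j i ≠ 0 →
        ¬ (((m - n ≤ (j.1 : ℕ) ∧ m - n ≤ (j.2 : ℕ)) ∨ j = (0, 0))) ∧
          (((m - n ≤ (i.1 : ℕ) ∧ m - n ≤ (i.2 : ℕ)) ∨ i = (0, 0)))) →
      ∀ k ≤ m, ∀ D ∈ J' k, linSubst (Fin m × Fin m) ℂ (1 + C) D ∈ J' k) →
    (∀ c : ℂ, c ≠ 0 → ∀ k ≤ m, ∀ D ∈ J' k,
      linSubst (Fin m × Fin m) ℂ (Matrix.diagonal fun i : Fin m × Fin m =>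
        if ((m - n ≤ (i.1 : ℕ) ∧ m - n ≤ (i.2 : ℕ)) ∨ i = (0, 0)) then 1 else c) D ∈ J' k) ∧
    (∀ L : Matrix.GeneralLinearGroup (Fin m × Fin m) ℂ,
      let M : Matrix (Fin m × Fin m) (Fin m × Fin m) ℂ := L
      let rk := fun (q : Fin m × Fin m) =>
        (if (m - n ≤ (q.1 : ℕ) ∧ m - n ≤ (q.2 : ℕ)) ∨ q = (0, 0) then 0 else m * m) + ((q.1 : ℕ) * m + (q.2 : ℕ))
      (∀ a : Fin m × Fin m, ((m - n ≤ (a.1 : ℕ) ∧ m - n ≤ (a.2 : ℕ)) ∨ a = (0, 0)) →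
        ∀ b : Fin m × Fin m, M b a = if b = a then 1 else 0) →
      (∀ i j : Fin m × Fin m, ¬ (((m - n ≤ (i.1 : ℕ) ∧ m - n ≤ (i.2 : ℕ)) ∨ i = (0, 0))) →
        ¬ (((m - n ≤ (j.1 : ℕ) ∧ m - n ≤ (j.2 : ℕ)) ∨ j = (0, 0))) → M j i ≠ 0 → rk j ≤ rk i) →
      ∀ k ≤ m, ∀ D ∈ J' k,
        linSubst (Fin m × Fin m) ℂ (((p⁻¹ : GL (Fin m × Fin m) ℂ) : Matrix (Fin m × Fin m) (Fin m × Fin m) ℂ) *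
          M * (p : Matrix (Fin m × Fin m) (Fin m × Fin m) ℂ))ᵀ D ∈ J' k) := by
  intro n m _ p J' hP1 hraw _
  -- the own columns of `p⁻¹` are coordinate vectors as well
  have hPi1 : ∀ a : Fin m × Fin m, ((m - n ≤ (a.1 : ℕ) ∧ m - n ≤ (a.2 : ℕ)) ∨ a = (0, 0)) →
      ∀ b : Fin m × Fin m,
        ((p⁻¹ : GL (Fin m × Fin m) ℂ) : Matrix (Fin m × Fin m) (Fin m × Fin m) ℂ) b a =
          if b = a then 1 else 0 :=
    fun a ha b => stabSB_inv_coordCol p.inv_mul (hP1 a ha) b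
  refine ⟨?_, ?_⟩
  · -- (i) clean scalings of the unused variables
    intro c hc k hk D hD
    have hdet : (Matrix.diagonal fun i : Fin m × Fin m =>
        if ((m - n ≤ (i.1 : ℕ) ∧ m - n ≤ (i.2 : ℕ)) ∨ i = (0, 0)) then (1 : ℂ) else c).det ≠ 0 := by
      rw [Matrix.det_diagonal]
      refine Finset.prod_ne_zero_iff.mpr fun i _ => ?_
      split_ifs
      exacts [one_ne_zero, hc]
    -- the scaling as an element of `GL`
    obtain ⟨Dg, hDg⟩ : ∃ Dg : GL (Fin m × Fin m) ℂ,
        (Dg : Matrix (Fin m × Fin m) (Fin m × Fin m) ℂ) = Matrix.diagonal fun i : Fin m × Fin m =>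
          if ((m - n ≤ (i.1 : ℕ) ∧ m - n ≤ (i.2 : ℕ)) ∨ i = (0, 0)) then (1 : ℂ) else c :=
      ⟨Matrix.GeneralLinearGroup.mkOfDetNeZero _ hdet,
        Matrix.GeneralLinearGroup.val_mkOfDetNeZero _ _⟩
    -- `p⁻¹ (p Dg p⁻¹) p = Dg`
    have hg : p⁻¹ * (p * Dg * p⁻¹) * p = Dg := by group
    have hconj : ((p⁻¹ : GL (Fin m × Fin m) ℂ) : Matrix (Fin m × Fin m) (Fin m × Fin m) ℂ) *
        ((p * Dg * p⁻¹ : GL (Fin m × Fin m) ℂ) : Matrix (Fin m × Fin m) (Fin m × Fin m) ℂ) *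
          (p : Matrix (Fin m × Fin m) (Fin m × Fin m) ℂ) =
        Matrix.diagonal fun i : Fin m × Fin m =>
          if ((m - n ≤ (i.1 : ℕ) ∧ m - n ≤ (i.2 : ℕ)) ∨ i = (0, 0)) then (1 : ℂ) else c := by
      rw [← Units.val_mul, ← Units.val_mul, hg, hDg]
    -- `p Dg p⁻¹ = c • 1 + (1 - c) • (diag 𝟙_own * p⁻¹)`
    have hA : ((p * Dg * p⁻¹ : GL (Fin m × Fin m) ℂ) : Matrix (Fin m × Fin m) (Fin m × Fin m) ℂ) =
        c • (1 : Matrix (Fin m × Fin m) (Fin m × Fin m) ℂ) +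
          (1 - c) • (Matrix.diagonal (fun i : Fin m × Fin m =>
            if ((m - n ≤ (i.1 : ℕ) ∧ m - n ≤ (i.2 : ℕ)) ∨ i = (0, 0)) then (1 : ℂ) else 0) *
            ((p⁻¹ : GL (Fin m × Fin m) ℂ) : Matrix (Fin m × Fin m) (Fin m × Fin m) ℂ)) := by
      rw [Units.val_mul, Units.val_mul, hDg]
      exact stabSB_conj_diagonal _ p.mul_inv hP1 c
    have h := hraw (p * Dg * p⁻¹)
    simp only [hconj, Matrix.diagonal_transpose] at h
    simp only [hA] at h
    refine h ?_ ?_ ?_ ?_ k hk D hD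
    · -- (a) triangularity for `rk`
      intro i j hij
      by_cases hji : j = i
      · subst hji
        exact le_rfl
      · obtain ⟨hj, hi⟩ := stabSB_conj_entry_offdiag _ hPi1 c hji hij
        rw [if_pos hj, if_neg hi, zero_add]
        have := fst_mul_add_snd_lt j
        omega
    · -- (b) own columns are diagonal
      intro i j hi hji
      by_contra hne
      exact (stabSB_conj_entry_offdiag _ hPi1 c hji hne).2 hi
    · -- (c) rank-one pattern on the block diagonal: all these entries are `1`
      intro i k' j l hi hk' hj hl
      rw [stabSB_conj_entry_diag _ hPi1 c (i := (i, j)) (Or.inl ⟨hi, hj⟩),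
        stabSB_conj_entry_diag _ hPi1 c (i := (k', l)) (Or.inl ⟨hk', hl⟩),
        stabSB_conj_entry_diag _ hPi1 c (i := (i, l)) (Or.inl ⟨hi, hl⟩),
        stabSB_conj_entry_diag _ hPi1 c (i := (k', j)) (Or.inl ⟨hk', hj⟩)]
    · -- (d) character `1`
      rw [stabSB_conj_entry_diag _ hPi1 c (i := (0, 0)) (Or.inr rfl), one_pow, one_mul]
      exact Finset.prod_eq_one fun i hi =>
        stabSB_conj_entry_diag _ hPi1 c (i := (i, i))
          (Or.inl ⟨(Finset.mem_filter.mp hi).2, (Finset.mem_filter.mp hi).2⟩)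
  · -- (ii) the conjugate of an own-trivial, unused-triangular `L`: `L ∈ H₀` verbatim
    intro L
    dsimp only
    intro hL1 hL2 k hk D hD
    have hLd : ∀ a : Fin m × Fin m, ((m - n ≤ (a.1 : ℕ) ∧ m - n ≤ (a.2 : ℕ)) ∨ a = (0, 0)) →
        (L : Matrix (Fin m × Fin m) (Fin m × Fin m) ℂ) a a = 1 :=
      fun a ha => (hL1 a ha a).trans (if_pos rfl)
    have h := hraw L
    dsimp only at h
    refine h ?_ ?_ ?_ ?_ k hk D hD
    · -- (a) triangularity for `rk`
      intro i j hij
      by_cases hji : j = i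
      · subst hji
        exact le_rfl
      · by_cases hi : (m - n ≤ (i.1 : ℕ) ∧ m - n ≤ (i.2 : ℕ)) ∨ i = (0, 0)
        · exact absurd ((hL1 i hi j).trans (if_neg hji)) hij
        · by_cases hj : (m - n ≤ (j.1 : ℕ) ∧ m - n ≤ (j.2 : ℕ)) ∨ j = (0, 0)
          · rw [if_pos hj, if_neg hi, zero_add]
            have := fst_mul_add_snd_lt j
            omega
          · exact hL2 i j hi hj hij
    · -- (b) own columns are diagonal
      intro i j hi hji
      rw [hL1 i hi j, if_neg hji]
    · -- (c) rank-one pattern on the block diagonal: all these entries are `1`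
      intro i k' j l hi hk' hj hl
      rw [hLd (i, j) (Or.inl ⟨hi, hj⟩), hLd (k', l) (Or.inl ⟨hk', hl⟩), hLd (i, l) (Or.inl ⟨hi, hl⟩),
        hLd (k', j) (Or.inl ⟨hk', hj⟩)]
    · -- (d) character `1`
      rw [hLd (0, 0) (Or.inr rfl), one_pow, one_mul]
      exact Finset.prod_eq_one fun i hi =>
        hLd (i, i) (Or.inl ⟨(Finset.mem_filter.mp hi).2, (Finset.mem_filter.mp hi).2⟩)

end Summit.ValiantsHypothesis.ValiantsHypothesis.Theorems.BorderApolarityToricWitnessObstructionQP
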